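import Literature.Computability.AlgebraicComplexity.RankOneDeterminantalExpressionsProofs

/-!
# Grenet's `7 × 7` representation of `per₃` is levelled (stub S6 of `UlrichPadded.OrbitCorankTwo`)

Support file for the crux `UlrichPadded.OrbitCorankTwo` (stmt-ValiantsHypothesis-15032), line
`SketchIdeator1`, stub `orbitCorankTwo_exists_levelled_seven`: there is an affine determinantal
representation `A` of `perPoly (Fin 3) ℂ` of size `7` together with integer row/column weights
`α, β : Fin 7 → ℤ` such that `α i + β j = 0` wherever the constant part of `A i j` is non-zero and
`α i + β j = 1` wherever the linear part of `A i j` is non-zero (a torus grading / levelling).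

Witness: Grenet's branching-program matrix `G` of `per₃` (rows/columns `s, u₀, u₁, u₂, v₀, v₁, v₂`;
row `s = (0, X(0,0), X(1,0), X(2,0), 0, 0, 0)`, unit diagonal on the `u`- and `v`-blocks,
`(u,v)`-block `!![0, X(2,1), X(1,1); X(2,1), 0, X(0,1); X(1,1), X(0,1), 0]`, column `s = X(k,2)` in
the `v`-rows), with weights `α = (1, 0, 0, 0, -1, -1, -1)`, `β = (2, 0, 0, 0, 1, 1, 1)`: the
constants sit at `(u_i,u_i)` (`0 + 0`) and `(v_i,v_i)` (`-1 + 1`), the variables at `(s,u_j)`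
(`1 + 0`), `(u_i,v_j)` (`0 + 1`) and `(v_i,s)` (`-1 + 2`). `det G = per₃` through the unipotent
factorisation `G · E₁ · E₂ = T`, `T` upper triangular with diagonal `(per₃, 1, …, 1)` (adapted from
`Theorems/GrenetRigidityOptimalUniqueRefutation.lean` and
`Theorems/UlrichPaddedNoTightInfinityRefutation.lean`).
-/

noncomputable section

namespace Summit.ValiantsHypothesis.Theorems

open MvPolynomial Matrix
open Literature.Computability.AlgebraicComplexity

-- one declaration inspecting all 49 entries of five explicit `7 × 7` matrices at once
set_option maxHeartbeats 1600000 in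
/-- Grenet's `7 × 7` matrix of `per₃` is an affine determinantal representation of
`perPoly (Fin 3) ℂ` that is LEVELLED: with row weights `(1, 0, 0, 0, -1, -1, -1)` and column weights
`(2, 0, 0, 0, 1, 1, 1)` (basis `s, u₀, u₁, u₂, v₀, v₁, v₂`) one has `α i + β j = 0` on the support of
the constant part and `α i + β j = 1` on the support of the linear part. Stub S6 of the line
`SketchIdeator1` for `UlrichPadded.OrbitCorankTwo` (stmt-ValiantsHypothesis-15032).
[cite: Grenet2011, Thm 1] -/
theorem orbitCorankTwo_exists_levelled_seven :
    ∃ (A : Matrix (Fin 7) (Fin 7) (MvPolynomial (Fin 3 × Fin 3) ℂ)) (α β : Fin 7 → ℤ),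
      IsAffineDetRepr (perPoly (Fin 3) ℂ) A ∧
      (∀ i j, MvPolynomial.constantCoeff (A i j) ≠ 0 → α i + β j = 0) ∧
      (∀ i j, MvPolynomial.homogeneousComponent 1 (A i j) ≠ 0 → α i + β j = 1) := by
  -- adapted from Theorems/GrenetRigidityOptimalUniqueRefutation.lean (`det_gA`) and
  -- Theorems/UlrichPaddedNoTightInfinityRefutation.lean (`big`)
  -- ### Grenet's matrix `G`, the eliminations `E1`, `E2`, the products `B = G * E1`, `T = B * E2`
  obtain ⟨G, hG⟩ : ∃ M : Matrix (Fin 7) (Fin 7) (MvPolynomial (Fin 3 × Fin 3) ℂ), M =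
      !![0, X (0,0), X (1,0), X (2,0), 0, 0, 0;
         0, 1, 0, 0, 0, X (2,1), X (1,1);
         0, 0, 1, 0, X (2,1), 0, X (0,1);
         0, 0, 0, 1, X (1,1), X (0,1), 0;
         X (0,2), 0, 0, 0, 1, 0, 0;
         X (1,2), 0, 0, 0, 0, 1, 0;
         X (2,2), 0, 0, 0, 0, 0, 1] := ⟨_, rfl⟩
  obtain ⟨E1, hE1⟩ : ∃ M : Matrix (Fin 7) (Fin 7) (MvPolynomial (Fin 3 × Fin 3) ℂ), M =
      !![1, 0, 0, 0, 0, 0, 0;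
         0, 1, 0, 0, 0, -X (2,1), -X (1,1);
         0, 0, 1, 0, -X (2,1), 0, -X (0,1);
         0, 0, 0, 1, -X (1,1), -X (0,1), 0;
         0, 0, 0, 0, 1, 0, 0;
         0, 0, 0, 0, 0, 1, 0;
         0, 0, 0, 0, 0, 0, 1] := ⟨_, rfl⟩
  obtain ⟨E2, hE2⟩ : ∃ M : Matrix (Fin 7) (Fin 7) (MvPolynomial (Fin 3 × Fin 3) ℂ), M =
      !![1, 0, 0, 0, 0, 0, 0;
         0, 1, 0, 0, 0, 0, 0;
         0, 0, 1, 0, 0, 0, 0;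
         0, 0, 0, 1, 0, 0, 0;
         -X (0,2), 0, 0, 0, 1, 0, 0;
         -X (1,2), 0, 0, 0, 0, 1, 0;
         -X (2,2), 0, 0, 0, 0, 0, 1] := ⟨_, rfl⟩
  obtain ⟨B, hB⟩ : ∃ M : Matrix (Fin 7) (Fin 7) (MvPolynomial (Fin 3 × Fin 3) ℂ), M =
      !![0, X (0,0), X (1,0), X (2,0), -(X (1,0) * X (2,1) + X (2,0) * X (1,1)),
           -(X (0,0) * X (2,1) + X (2,0) * X (0,1)), -(X (0,0) * X (1,1) + X (1,0) * X (0,1));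
         0, 1, 0, 0, 0, 0, 0;
         0, 0, 1, 0, 0, 0, 0;
         0, 0, 0, 1, 0, 0, 0;
         X (0,2), 0, 0, 0, 1, 0, 0;
         X (1,2), 0, 0, 0, 0, 1, 0;
         X (2,2), 0, 0, 0, 0, 0, 1] := ⟨_, rfl⟩
  obtain ⟨T, hT⟩ : ∃ M : Matrix (Fin 7) (Fin 7) (MvPolynomial (Fin 3 × Fin 3) ℂ), M =
      !![perPoly (Fin 3) ℂ, X (0,0), X (1,0), X (2,0), -(X (1,0) * X (2,1) + X (2,0) * X (1,1)),
           -(X (0,0) * X (2,1) + X (2,0) * X (0,1)), -(X (0,0) * X (1,1) + X (1,0) * X (0,1));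
         0, 1, 0, 0, 0, 0, 0;
         0, 0, 1, 0, 0, 0, 0;
         0, 0, 0, 1, 0, 0, 0;
         0, 0, 0, 0, 1, 0, 0;
         0, 0, 0, 0, 0, 1, 0;
         0, 0, 0, 0, 0, 0, 1] := ⟨_, rfl⟩
  -- ### the levelling weights (basis `s, u₀, u₁, u₂, v₀, v₁, v₂`)
  obtain ⟨α, hα⟩ : ∃ w : Fin 7 → ℤ, w = ![1, 0, 0, 0, -1, -1, -1] := ⟨_, rfl⟩
  obtain ⟨β, hβ⟩ : ∃ w : Fin 7 → ℤ, w = ![2, 0, 0, 0, 1, 1, 1] := ⟨_, rfl⟩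
  have p3 : perPoly (Fin 3) ℂ = X (0,0) * (X (1,1) * X (2,2) + X (2,1) * X (1,2))
      + X (1,0) * (X (0,1) * X (2,2) + X (2,1) * X (0,2))
      + X (2,0) * (X (0,1) * X (1,2) + X (1,1) * X (0,2)) := by
    simp [perPoly, permanent_fin_three, Matrix.mvPolynomialX_apply]
  have hX1 : ∀ v : Fin 3 × Fin 3,
      homogeneousComponent 1 (X v : MvPolynomial (Fin 3 × Fin 3) ℂ) = X v :=
    fun v => homogeneousComponent_eq_self (isHomogeneous_X ℂ v)
  have h11 : homogeneousComponent 1 (1 : MvPolynomial (Fin 3 × Fin 3) ℂ) = 0 :=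
    homogeneousComponent_eq_zero _ _ (by simp)
  -- ### ONE inspection of the 49 entries: the two products, triangularity, degrees, the two
  -- weight conditions
  have big : ∀ i j : Fin 7,
      ((G * E1) i j = B i j ∧ (B * E2) i j = T i j) ∧
      ((j < i → E1 i j = 0) ∧ (i < j → E2 i j = 0) ∧ (j < i → T i j = 0)) ∧
      (G i j).totalDegree ≤ 1 ∧
      (constantCoeff (G i j) ≠ 0 → α i + β j = 0) ∧
      (homogeneousComponent 1 (G i j) ≠ 0 → α i + β j = 1) := by
    intro i j
    rw [hG, hE1, hE2, hB, hT, hα, hβ, p3]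
    fin_cases i <;> fin_cases j <;> refine ⟨⟨?_, ?_⟩, ⟨?_, ?_, ?_⟩, ?_, ?_, ?_⟩ <;>
      simp [Matrix.mul_apply, Fin.sum_univ_seven, totalDegree_X, hX1, h11]
    all_goals ring
  -- ### `det G = per₃` through `G * E1 * E2 = T`, `T` upper triangular with diagonal `(per₃, 1, …, 1)`
  have detG : G.det = perPoly (Fin 3) ℂ := by
    have h1 : G * E1 = B := Matrix.ext fun i j => (big i j).1.1
    have h2 : B * E2 = T := Matrix.ext fun i j => (big i j).1.2
    have dE1 : E1.det = 1 := by
      rw [Matrix.det_of_upperTriangular (M := E1) fun i j hij => (big i j).2.1.1 hij,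
        Fin.prod_univ_seven, hE1]
      simp
    have dE2 : E2.det = 1 := by
      rw [Matrix.det_of_lowerTriangular E2 (fun i j hij => (big i j).2.1.2.1 hij),
        Fin.prod_univ_seven, hE2]
      simp
    have dT : T.det = perPoly (Fin 3) ℂ := by
      rw [Matrix.det_of_upperTriangular (M := T) fun i j hij => (big i j).2.1.2.2 hij,
        Fin.prod_univ_seven, hT]
      simp
    have h := congrArg Matrix.det h2
    rwa [← h1, Matrix.det_mul, Matrix.det_mul, dE1, dE2, dT, mul_one, mul_one] at h
  exact ⟨G, α, β, ⟨fun i j => (big i j).2.2.1, detG⟩, fun i j => (big i j).2.2.2.1,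
    fun i j => (big i j).2.2.2.2⟩

end Summit.ValiantsHypothesis.Theorems
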